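import Summits.CriticalPhenomena.PercolationContinuityZ3.Theses.PercExchangeRateTransport
import Summits.CriticalPhenomena.PercolationContinuityZ3.Theorems.PercNearOneGluingNoHeavyLowerTailCSHTheoremOne
import Literature.Probability.Percolation.BernoulliPercolationProofs
import Literature.Probability.Percolation.CriticalContinuityProofs
import Mathlib.Topology.Order.OrderClosed
import Mathlib.Topology.MetricSpace.Basic
import HarnessLib

/-!
# `PercExchangeRateTransport.AnchorVanishing` (stmt-CriticalPhenomena-16069) — SETTLED after continuity

Item `stmt-CriticalPhenomena-16069` of route `CriticalPhenomena/PercExchangeRateTransport` (support (M)): the free anchor: `J(t) → 0` as `t ↓ 0` (the exchange curve's percolation density vanishes at the planar end).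

From the item's own hypotheses: every `p ∈ (p_c(ℤ²), 1]` percolates already in the planar section `t = 0` (ModelFacts: `θ(p,0) = θ_{ℤ²}(p)`, monotone in `t`), so `p_c(t) ≤ p_c(ℤ²)` for all `t ≥ 0`; `θ(p_c(ℤ²), t) = inf_n Θ_n(p_c(ℤ²), t)`, `Θ_n` continuous, and `inf_n Θ_n(p_c(ℤ²), 0) = θ_{ℤ²}(p_c(ℤ²)) = 0` by the hypothesis `PercolationContinuity 2` — upper semicontinuity in `t` at the planar point.  No uniformity near the planar end is used.  p205010 is NOT used (the planar continuity enters as the item's hypothesis).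

builds on p205010 (kernel theorem, internal audit signed; external expert review pending) — USED (`CSH.percolationContinuityZ3_holds`).  RSW3 lane, lead gen 28 (prover-prim-rsw3-lead-g28-0):
'after continuity — the ledger harvest'.
References: G. Kozma, N. Nitzan (2024), Thm. 6 / Conj. 3 [KozmaNitzan2024]; G. Grimmett, *Percolation* (1999), §8 [GrimmettPercolation1999].
-/

noncomputable section

namespace Summit.CriticalPhenomena.PercolationContinuityZ3.Theorems

namespace PercExchangeRateTransportAnchorVanishing

open MeasureTheory Literature.Probability.Percolation Literature.Probability.LatticeModels
open Filter Topology

/-- **`PercExchangeRateTransport.AnchorVanishing` (stmt-CriticalPhenomena-16069), settled.**  `p_c(t) ≤ p_c(ℤ²)`, `J(t) ≤ Θ_n(p_c(ℤ²), t) → Θ_n(p_c(ℤ²), 0) < ε`.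
[cite: KozmaNitzan2024, Thm. 6 with Conj. 3 (p. 15)] -/
theorem anchorVanishing_proof : Summit.CriticalPhenomena.PercolationContinuityZ3.Theses.PercExchangeRateTransport.AnchorVanishing := by
  intro hM hPc hK2
  -- local names for the objects of the statement (definitionally the decl's `let`s)
  let vert : Sym2 (Site 3) → Prop := fun e => ∃ x : Site 3, e = s(x, x + Pi.single (2 : Fin 3) 1)
  let cfg : ℝ → ℝ → (Sym2 (Site 3) → ℝ) → Set (Sym2 (Site 3)) := fun p t U =>
    {e | e ∈ (zdGraph 3).edgeSet ∧ ((vert e ∧ U e ≤ t) ∨ (¬ vert e ∧ U e ≤ p))}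
  let Θ : ℕ → ℝ → ℝ → ℝ := fun n p t => (labelMeasure (Site 3)).real {U | cfg p t U ∈ siteToBoundary 3 n}
  let θ : ℝ → ℝ → ℝ := fun p t => (labelMeasure (Site 3)).real {U | cfg p t U ∈ percolatesAt (0 : Site 3)}
  let pc : ℝ → ℝ := fun t => sInf ({p : ℝ | 0 ≤ p ∧ p ≤ 1 ∧ 0 < θ p t} ∪ {1})
  obtain ⟨hcontΘ, -, hmonoP, hmonoT, -, hbd, hinf, -, -, hplanar⟩ := hM
  obtain ⟨hpc0, hpc1⟩ := hPc 2 (by norm_num)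
  set p₂ : ℝ := criticalProb (zdGraph 2) (0 : Site 2) with hp₂
  have hbddΘ : ∀ p t : ℝ, BddBelow (Set.range fun n => Θ n p t) := fun p t =>
    ⟨0, by rintro _ ⟨n, rfl⟩; exact (hbd n p t).1⟩
  -- θ is monotone in p and in t, and `θ ≤ Θ_n`
  have hθmono : ∀ t p p' : ℝ, p ≤ p' → θ p t ≤ θ p' t := by
    intro t p p' hpp'
    refine (le_of_eq (hinf p t)).trans ((ciInf_mono (hbddΘ p t) fun n => hmonoP n t hpp').trans (le_of_eq (hinf p' t).symm))
  have hθmonoT : ∀ p t t' : ℝ, t ≤ t' → θ p t ≤ θ p t' := by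
    intro p t t' htt'
    refine (le_of_eq (hinf p t)).trans ((ciInf_mono (hbddΘ p t) fun n => hmonoT n p htt').trans (le_of_eq (hinf p t').symm))
  have hθleΘ : ∀ n p t, θ p t ≤ Θ n p t := fun n p t => (le_of_eq (hinf p t)).trans (ciInf_le (hbddΘ p t) n)
  -- the planar section `t = 0` is Bernoulli percolation on ℤ²; at `p₂ = p_c(ℤ²)` its infimum over `n` is `θ_{ℤ²}(p_c) = 0`
  have hp₂I : 0 ≤ p₂ ∧ p₂ ≤ 1 := ⟨hpc0.le, hpc1.le⟩
  have hθp₂ : θ p₂ 0 = 0 := by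
    have h := hplanar ⟨p₂, hp₂I⟩
    have hK : theta (zdGraph 2) 0 ⟨p₂, hp₂I⟩ = 0 := by
      have e : (⟨p₂, hp₂I⟩ : unitInterval) = criticalProbI 2 := Subtype.ext (by rw [coe_criticalProbI])
      rw [e]; exact hK2
    exact h.trans hK
  -- `pc t ≤ p₂` for every `t ≥ 0`: every `p ∈ (p₂, 1]` percolates already in the planar section
  have hpc_le : ∀ t : ℝ, 0 ≤ t → pc t ≤ p₂ := by
    intro t ht
    have hbdd : BddBelow ({p : ℝ | 0 ≤ p ∧ p ≤ 1 ∧ 0 < θ p t} ∪ {1}) :=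
      ⟨0, by
        rintro p (⟨hp, -, -⟩ | hp)
        · exact hp
        · rw [Set.mem_singleton_iff.1 hp]; exact zero_le_one⟩
    refine le_of_forall_gt_imp_ge_of_dense fun p hp => ?_
    by_cases hp1 : p ≤ 1
    · refine csInf_le hbdd (Or.inl ⟨hpc0.le.trans hp.le, hp1, ?_⟩)
      have hpos : 0 < θ p 0 := by
        have e : θ p 0 = theta (zdGraph 2) 0 ⟨p, hpc0.le.trans hp.le, hp1⟩ := hplanar ⟨p, hpc0.le.trans hp.le, hp1⟩
        rw [e]
        exact theta_pos_of_criticalProb_lt_holds (zdGraph 2) (0 : Site 2) _ (by exact hp)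
      exact hpos.trans_le (hθmonoT p 0 t ht)
    · push Not at hp1
      exact (csInf_le hbdd (Or.inr rfl)).trans hp1.le
  -- given ε: a level `n` with `Θ_n(p₂, 0) < ε`, then continuity of `Θ_n(p₂, ·)` at `t = 0`
  intro ε hε
  have hinf0 : (⨅ n, Θ n p₂ 0) < ε := by
    have e : θ p₂ 0 = ⨅ n, Θ n p₂ 0 := hinf p₂ 0
    rw [← e, hθp₂]; exact hε
  obtain ⟨n, hn⟩ := exists_lt_of_ciInf_lt hinf0
  have hc : ContinuousAt (fun t : ℝ => Θ n p₂ t) 0 :=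
    ((hcontΘ n).comp (Continuous.prodMk continuous_const continuous_id)).continuousAt
  have hev : ∀ᶠ t : ℝ in 𝓝 0, Θ n p₂ t < ε := hc.eventually (gt_mem_nhds hn)
  obtain ⟨δ, hδ, hball⟩ := Metric.eventually_nhds_iff.1 hev
  refine ⟨δ, hδ, fun t ht0 htδ => ?_⟩
  have hdist : dist t 0 < δ := by rw [Real.dist_eq, sub_zero, abs_of_pos ht0]; exact htδ
  calc θ (pc t) t ≤ θ p₂ t := hθmono t _ _ (hpc_le t ht0.le)
    _ ≤ Θ n p₂ t := hθleΘ n p₂ t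
    _ ≤ ε := (hball hdist).le

end PercExchangeRateTransportAnchorVanishing

end Summit.CriticalPhenomena.PercolationContinuityZ3.Theorems

end
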